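import Summits.ResolutionOfSingularities.ResolutionOfSingularities.Theorems.WildConesConeExit
import Summits.ResolutionOfSingularities.ResolutionOfSingularities.Theorems.WildConesNarrowRunsDie
import Summits.ResolutionOfSingularities.ResolutionOfSingularities.Theorems.WildConesClassicalRegimesDefs
import HarnessLib

/-!
# [OURS · L1 W4.6, rung (i) WITH A NUMBER in EVERY dimension — brick 20] The death of narrow runs is EFFECTIVE:
# for `p` odd and `n ≥ 3`, no run of route `WildCones`' point-blow-up calculus has its first `D + 2` states isolated
# of multiplicity `p`, where `u_{i₀}^D ∈ (∂a₀)`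

Cell res-hironaka (LADDER-RESOLUTION rung L, D-0089), slot W4.6, seat res-L1-s46-pv-2 (gen 4). Host: route
`WildCones`, crux `ClassicalRegimes` (stmt-ResolutionOfSingularities-16884), `--supports … --as helper`.

HONEST FRAMING. Everything here is OURS: a re-assembly, with BOUNDED hypotheses, of the tree's proofs of the cruxes
`NarrowRunsDie` (stmt-16882; line `derivlift`: `Theorems/WildConesNarrowRunsDie*.lean`) and `ConeExit` (stmt-16883;
`Theorems/WildConesConeExit*.lean`) of route `WildCones`. NOTHING here is a statement of H. Hironaka's manuscript
[Hironaka2017]; no FACT-LIST premise. AI review is weaker than expert review.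

## Why, and what

The crux `NarrowRunsDie` is stated for INFINITE runs («no infinite narrow isolated multiplicity-`p` run»), and so is the
route's target; the forced-atom rung of slot W4.6 therefore had a NUMBER (an exit bound `FinLocalExitBound`) only in the
classical regimes `n ≤ 2 ∨ p = 2`, where the Milnor number drops (`…ForcedAtomExitBound`, p524336), and mere termination
for `n ≥ 3`, `p` odd (p523688). But the tree's PROOF of `NarrowRunsDie` is effective: it derives a contradiction at the
finite stage `D + 1`, `D` being any exponent with `u_{i 0}^D ∈ jac c₀` (Artinian stabilisation), from the Frobenius
coset `Φ_{D+1}(a₀) = π^p a_{D+1} + b^p` (which needs multiplicity `p` at the stages `≤ D`), the derivation lift, and the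
FREENESS of the word below `D` (which needs multiplicity `p` at the stages `≤ D + 1` and cone-invariance rank `dL = 1`
below `D` — supplied by `ConeExit` from isolatedness and multiplicity `p` at consecutive stages `≤ D`). This file
re-runs that proof with every hypothesis bounded:

* `free_shape_of_lt`, `endgame_of_lt` — the free endgame of stub `stub_freeEndgame` with freeness assumed only below
  `D` and divisibility only at stage `D + 1`, `D` GIVEN with `u_{i 0}^D ∈ (g)`;
* `coset_of_lt` — the Frobenius coset of stub `stub_coset` at stage `m` from multiplicity `p` at the stages `< m`;
* `false_of_isol_multP_le` — **for `p` odd, `n ≥ 3`, `κ` perfect: if `u_{i 0}^D ∈ jac c₀` and the states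
  `run c₀ i t m`, `m ≤ D + 1`, are all isolated of multiplicity `p`, then `False`.** Hence an isolated
  multiplicity-`p` run from `c₀` has at most `D + 1` states; with `𝔪^D ≤ jac c₀` the bound is uniform in the word
  (`false_of_isol_multP_le'`), and `D` can be taken to be the Milnor number `μ(c₀)` (companion file, brick 21).

References: `Theorems/WildConesNarrowRunsDie.lean` (`NarrowRunsDie_proof`, `nrd_nearInvariant`, `nrd_transversal`),
`…NarrowRunsDieStub{Coset,PartialsDivisible,FreeEndgame,Dict}.lean`, `…WildConesConeExit.lean` (`ConeExit_proof`);
V. Cossart, U. Jannsen, S. Saito, *Desingularization: invariants and strategy*, LNM 2270 (2020), Thm. 2.14, Cor. 6.37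
(near points lie on the directrix); H. Hauser, S. Perlega, arXiv:1802.05010 §1 (the forced-cycle question).
[CossartJannsenSaito2020] [HauserPerlega2019] [folklore]
-/

noncomputable section

-- single-problem summit: the doubled namespace component `ResolutionOfSingularities` is forced
set_option linter.dupNamespace false

open scoped BigOperators Classical
open MvPowerSeries

namespace Summit.ResolutionOfSingularities.ResolutionOfSingularities.Theorems

namespace CampaignW46.NarrowRunsBound

open WildCones
open NarrowRunsDie (stub_dict coset_exists_pow_eq endgame_sub_algHom endgame_constantCoeff_sub endgame_sub_X_self
  endgame_sub_X_ne endgame_Phi_hom pdiv_main)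

variable {n : ℕ} {κ : Type} [Field κ]

/-! ## The free endgame with bounded freeness -/

/-- [OURS · L1 W4.6] **Free shape up to stage `m + 1` from freeness below `m`**: along a word FREE at the steps
`k < m`, `π_{m+1} = u_{i m}^{m+1} · U` and `Φ_{m+1}(u_{i 0}) = u_{i m} · V` with `U(0), V(0) ≠ 0` (the tree's
`endgame_free_shape` with its hypothesis bounded). [folklore] -/
theorem free_shape_of_lt
    (sub : Fin n → (Fin n → κ) → MvPowerSeries (Fin n) κ → MvPowerSeries (Fin n) κ)
    (hsub : ∀ (i : Fin n) (τ : Fin n → κ) (f : MvPowerSeries (Fin n) κ), sub i τ f =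
      MvPowerSeries.subst (fun j : Fin n => @ite (MvPowerSeries (Fin n) κ) (j = i) (Classical.dec _)
        (MvPowerSeries.X i) (MvPowerSeries.X i * (MvPowerSeries.X j + MvPowerSeries.C (τ j)))) f)
    (i : ℕ → Fin n) (t : ℕ → Fin n → κ)
    (Phi : ℕ → MvPowerSeries (Fin n) κ → MvPowerSeries (Fin n) κ) (piE : ℕ → MvPowerSeries (Fin n) κ)
    (hPhi0 : ∀ f, Phi 0 f = f) (hPhiS : ∀ m f, Phi (m + 1) f = sub (i m) (t m) (Phi m f))
    (hpiE0 : piE 0 = 1) (hpiES : ∀ m, piE (m + 1) = X (i m) * sub (i m) (t m) (piE m)) (m : ℕ)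
    (hfree : ∀ k < m, i (k + 1) = i k ∨ t (k + 1) (i k) ≠ 0) :
    ∃ U V : MvPowerSeries (Fin n) κ, constantCoeff U ≠ 0 ∧ constantCoeff V ≠ 0 ∧
      piE (m + 1) = X (i m) ^ (m + 1) * U ∧ Phi (m + 1) (X (i 0)) = X (i m) * V := by
  induction m with
  | zero =>
    obtain ⟨ψ, hψ⟩ := endgame_sub_algHom sub hsub (i 0) (t 0)
    refine ⟨1, 1, by simp, by simp, ?_, ?_⟩
    · rw [hpiES, hpiE0, hψ, map_one]; ring
    · rw [hPhiS, hPhi0, endgame_sub_X_self sub hsub]; ring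
  | succ m ih =>
    obtain ⟨U, V, hU, hV, hpi, hPhi⟩ := ih fun k hk => hfree k (Nat.lt_succ_of_lt hk)
    obtain ⟨ψ, hψ⟩ := endgame_sub_algHom sub hsub (i (m + 1)) (t (m + 1))
    have hcc : ∀ f, constantCoeff (ψ f) = constantCoeff f := fun f => by
      rw [← hψ, endgame_constantCoeff_sub sub hsub]
    obtain ⟨W, hW, hWeq⟩ : ∃ W : MvPowerSeries (Fin n) κ, constantCoeff W ≠ 0 ∧
        ψ (X (i m)) = X (i (m + 1)) * W := by
      by_cases h : i (m + 1) = i m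
      · refine ⟨1, by simp, ?_⟩
        rw [← hψ, ← h, endgame_sub_X_self sub hsub, mul_one]
      · have ht : t (m + 1) (i m) ≠ 0 := (hfree m (Nat.lt_succ_self m)).resolve_left h
        refine ⟨X (i m) + C (t (m + 1) (i m)), by simpa using ht, ?_⟩
        rw [← hψ]
        exact endgame_sub_X_ne sub hsub (i (m + 1)) (i m) (t (m + 1)) (Ne.symm h)
    refine ⟨W ^ (m + 1) * ψ U, W * ψ V, ?_, ?_, ?_, ?_⟩
    · rw [map_mul, map_pow, hcc]
      exact mul_ne_zero (pow_ne_zero _ hW) hU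
    · rw [map_mul, hcc]
      exact mul_ne_zero hW hV
    · rw [hpiES, hpi, hψ, map_mul, map_pow, hWeq]; ring
    · rw [hPhiS, hPhi, hψ, map_mul, hWeq]; ring

/-- [OURS · L1 W4.6] **The free endgame at a GIVEN stage** (the tree's `endgame_main` with bounded hypotheses): if
`u_{i 0}^D ∈ (g_1, …, g_n)`, the word is free below `D`, and `π_{D+1} Φ_{D+1}(g_l) ∈ (π_{D+1}^p)` for every `l`, then
`False` — compare the coefficient of `u_{i D}^{2D+1}` in `π_{D+1} Φ_{D+1}(u_{i 0})^D`. [folklore] -/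
theorem endgame_of_lt
    (sub : Fin n → (Fin n → κ) → MvPowerSeries (Fin n) κ → MvPowerSeries (Fin n) κ)
    (hsub : ∀ (i : Fin n) (τ : Fin n → κ) (f : MvPowerSeries (Fin n) κ), sub i τ f =
      MvPowerSeries.subst (fun j : Fin n => @ite (MvPowerSeries (Fin n) κ) (j = i) (Classical.dec _)
        (MvPowerSeries.X i) (MvPowerSeries.X i * (MvPowerSeries.X j + MvPowerSeries.C (τ j)))) f)
    (i : ℕ → Fin n) (t : ℕ → Fin n → κ)
    (Phi : ℕ → MvPowerSeries (Fin n) κ → MvPowerSeries (Fin n) κ) (piE : ℕ → MvPowerSeries (Fin n) κ)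
    (p : ℕ) (hp : 2 ≤ p) (g : Fin n → MvPowerSeries (Fin n) κ)
    (hPhi0 : ∀ f, Phi 0 f = f) (hPhiS : ∀ m f, Phi (m + 1) f = sub (i m) (t m) (Phi m f))
    (hpiE0 : piE 0 = 1) (hpiES : ∀ m, piE (m + 1) = X (i m) * sub (i m) (t m) (piE m)) {D : ℕ}
    (hD : (X (i 0) : MvPowerSeries (Fin n) κ) ^ D ∈ Ideal.span (Set.range g))
    (hfree : ∀ k < D, i (k + 1) = i k ∨ t (k + 1) (i k) ≠ 0)
    (hdiv : ∀ l : Fin n, ∃ h' : MvPowerSeries (Fin n) κ,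
        piE (D + 1) * Phi (D + 1) (g l) = piE (D + 1) ^ p * h') : False := by
  classical
  obtain ⟨r, hr⟩ := Ideal.mem_span_range_iff_exists_fun.mp hD
  obtain ⟨U, V, hU, hV, hpi, hPhi⟩ :=
    free_shape_of_lt sub hsub i t Phi piE hPhi0 hPhiS hpiE0 hpiES D hfree
  obtain ⟨φ, hφ⟩ := endgame_Phi_hom sub hsub i t Phi hPhi0 hPhiS (D + 1)
  choose h' hh' using hdiv
  have key : piE (D + 1) * Phi (D + 1) (X (i 0)) ^ D =
      piE (D + 1) ^ p * ∑ l, φ (r l) * h' l := by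
    have hsum : Phi (D + 1) (X (i 0)) ^ D = ∑ l, φ (r l) * Phi (D + 1) (g l) := by
      simp only [hφ]
      rw [← map_pow, ← hr, map_sum]
      simp only [map_mul]
    rw [hsum, Finset.mul_sum, Finset.mul_sum]
    refine Finset.sum_congr rfl fun l _ => ?_
    rw [mul_left_comm, hh' l]; ring
  rw [hpi, hPhi] at key
  have lhs : coeff (Finsupp.single (i D) (D + 1 + D)) (X (i D) ^ (D + 1) * U * (X (i D) * V) ^ D) =
      constantCoeff U * constantCoeff V ^ D := by
    have : X (i D) ^ (D + 1) * U * (X (i D) * V) ^ D =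
        monomial (Finsupp.single (i D) (D + 1 + D)) (1 : κ) * (U * V ^ D) := by
      rw [← X_pow_eq]; ring
    rw [this, coeff_monomial_mul, if_pos le_rfl, tsub_self, one_mul,
      coeff_zero_eq_constantCoeff_apply, map_mul, map_pow]
  have rhs : coeff (Finsupp.single (i D) (D + 1 + D))
      ((X (i D) ^ (D + 1) * U) ^ p * ∑ l, φ (r l) * h' l) = 0 := by
    have hdvd : (X (i D) : MvPowerSeries (Fin n) κ) ^ ((D + 1) * p) ∣
        (X (i D) ^ (D + 1) * U) ^ p * ∑ l, φ (r l) * h' l :=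
      ⟨U ^ p * ∑ l, φ (r l) * h' l, by rw [pow_mul]; ring⟩
    rw [X_pow_dvd_iff] at hdvd
    apply hdvd
    simp only [Finsupp.single_eq_same]
    calc D + 1 + D < (D + 1) * 2 := by omega
      _ ≤ (D + 1) * p := Nat.mul_le_mul_left _ hp
  rw [key, rhs] at lhs
  exact mul_ne_zero hU (pow_ne_zero _ hV) lhs.symm

/-! ## The Frobenius coset with bounded multiplicity hypotheses -/

/-- [OURS · L1 W4.6] **The Frobenius coset at stage `m` from multiplicity `p` at the stages `< m`** (the tree's
`stub_coset`, bounded): `Φ_m(a₀) = π_m^p · a_m + b^p` in `κ⟦u⟧`, `a_m = ser (run c₀ i t m)`, over a perfect field of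
characteristic `p`; `sub`, `Phi`, `piE` are the chart substitution, its composites along the word and the pushed
product of exceptional variables, given abstractly by their defining equations. [folklore] -/
theorem coset_of_lt (p : ℕ) (hp : p.Prime) [CharP κ p] [PerfectField κ]
    (sub : Fin n → (Fin n → κ) → MvPowerSeries (Fin n) κ → MvPowerSeries (Fin n) κ)
    (hsub : ∀ (i : Fin n) (τ : Fin n → κ) (f : MvPowerSeries (Fin n) κ), sub i τ f =
      MvPowerSeries.subst (fun j : Fin n => @ite (MvPowerSeries (Fin n) κ) (j = i) (Classical.dec _)
        (MvPowerSeries.X i) (MvPowerSeries.X i * (MvPowerSeries.X j + MvPowerSeries.C (τ j)))) f)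
    (c₀ : (Fin n → ℕ) → κ) (i : ℕ → Fin n) (t : ℕ → Fin n → κ)
    (Phi : ℕ → MvPowerSeries (Fin n) κ → MvPowerSeries (Fin n) κ) (piE : ℕ → MvPowerSeries (Fin n) κ)
    (hPhi0 : ∀ f, Phi 0 f = f) (hPhiS : ∀ m f, Phi (m + 1) f = sub (i m) (t m) (Phi m f))
    (hpiE0 : piE 0 = 1) (hpiES : ∀ m, piE (m + 1) = X (i m) * sub (i m) (t m) (piE m)) (m : ℕ)
    (hmult : ∀ k < m, MultP p n κ (run p n κ c₀ i t k)) :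
    ∃ b : MvPowerSeries (Fin n) κ,
      Phi m (ser p n κ c₀) = piE m ^ p * ser p n κ (run p n κ c₀ i t m) + b ^ p := by
  haveI : Fact p.Prime := ⟨hp⟩
  haveI : CharP (MvPowerSeries (Fin n) κ) p :=
    charP_of_injective_ringHom (f := (MvPowerSeries.C : κ →+* MvPowerSeries (Fin n) κ))
      MvPowerSeries.C_injective p
  -- KEY ONE-STEP FACT: `σ_k(a_k) = X_{i k}^p * (a_{k+1} + g^p)` from multiplicity `p` at stage `k`
  have hkey : ∀ k : ℕ, MultP p n κ (run p n κ c₀ i t k) → ∃ g : MvPowerSeries (Fin n) κ,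
      sub (i k) (t k) (ser p n κ (run p n κ c₀ i t k)) =
        MvPowerSeries.X (i k) ^ p * (ser p n κ (run p n κ c₀ i t (k + 1)) + g ^ p) := by
    intro k hM
    have hM' : (∃ A, clean p n κ (run p n κ c₀ i t k) A ≠ 0) ∧
        ∀ A, clean p n κ (run p n κ c₀ i t k) A ≠ 0 → p ≤ Finset.sum Finset.univ (fun j => A j) := hM
    obtain ⟨⟨A₀, hA₀⟩, hbound⟩ := hM'
    -- (a) the step divides by `u_i^p`
    have hpo : p ≤ ord n κ (clean p n κ (run p n κ c₀ i t k)) := by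
      change p ≤ sInf {m' : ℕ | ∃ A, clean p n κ (run p n κ c₀ i t k) A ≠ 0 ∧
        m' = Finset.sum Finset.univ (fun j => A j)}
      exact le_csInf ⟨Finset.sum Finset.univ (fun j => A₀ j), A₀, hA₀, rfl⟩
        (by rintro _ ⟨A, hA, rfl⟩; exact hbound A hA)
    have hrun : run p n κ c₀ i t (k + 1) =
        clean p n κ (tr n κ (i k) (t k) p (dv n κ (i k) p (bl n κ (i k) (clean p n κ (run p n κ c₀ i t k))))) := by
      change clean p n κ (tr n κ (i k) (t k) (@ite ℕ (p ≤ ord n κ (clean p n κ (run p n κ c₀ i t k)))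
          (Classical.dec _) p 0) (dv n κ (i k) (@ite ℕ (p ≤ ord n κ (clean p n κ (run p n κ c₀ i t k)))
          (Classical.dec _) p 0) (bl n κ (i k) (clean p n κ (run p n κ c₀ i t k))))) = _
      rw [if_pos hpo]
    -- (b) the one-blow-up dictionary (stub `stub_dict` of crux `NarrowRunsDie`)
    have hdict : sub (i k) (t k) (ser p n κ (run p n κ c₀ i t k)) = MvPowerSeries.X (i k) ^ p *
        (show MvPowerSeries (Fin n) κ from fun A : Fin n →₀ ℕ =>
          tr n κ (i k) (t k) p (dv n κ (i k) p (bl n κ (i k) (clean p n κ (run p n κ c₀ i t k)))) ⇑A) := by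
      rw [hsub]
      exact stub_dict n κ (clean p n κ (run p n κ c₀ i t k)) (i k) (t k) p hbound
    -- (d) the `p`-divisible part of the moved coefficient function is a `p`-th power
    obtain ⟨g, hg⟩ := coset_exists_pow_eq p κ
      (tr n κ (i k) (t k) p (dv n κ (i k) p (bl n κ (i k) (clean p n κ (run p n κ c₀ i t k)))))
    refine ⟨g, ?_⟩
    rw [hdict, hg]
    congr 1
    -- (c) `clean` is idempotent
    apply MvPowerSeries.ext
    intro A
    rw [map_add]
    change tr n κ (i k) (t k) p (dv n κ (i k) p (bl n κ (i k) (clean p n κ (run p n κ c₀ i t k)))) ⇑A =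
      clean p n κ (run p n κ c₀ i t (k + 1)) ⇑A +
        @ite κ (∀ j, p ∣ A j) (Classical.dec _)
          (tr n κ (i k) (t k) p (dv n κ (i k) p (bl n κ (i k) (clean p n κ (run p n κ c₀ i t k)))) ⇑A) 0
    rw [hrun]
    change _ = @ite κ (∀ j, p ∣ A j) (Classical.dec _) 0 (@ite κ (∀ j, p ∣ A j) (Classical.dec _) 0
        (tr n κ (i k) (t k) p (dv n κ (i k) p (bl n κ (i k) (clean p n κ (run p n κ c₀ i t k)))) ⇑A)) + _
    by_cases h : ∀ j, p ∣ (A : Fin n → ℕ) j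
    · simp only [if_pos h, zero_add]
    · simp only [if_neg h, add_zero]
  -- INDUCTION on `m`
  induction m with
  | zero =>
    refine ⟨0, ?_⟩
    rw [hPhi0, hpiE0, one_pow, one_mul, zero_pow hp.ne_zero, add_zero]
    rfl
  | succ m ih =>
    obtain ⟨b, hb⟩ := ih fun k hk => hmult k (Nat.lt_succ_of_lt hk)
    obtain ⟨g, hg⟩ := hkey m (hmult m (Nat.lt_succ_self m))
    obtain ⟨ψ, hψ⟩ := endgame_sub_algHom sub hsub (i m) (t m)
    refine ⟨MvPowerSeries.X (i m) * sub (i m) (t m) (piE m) * g + sub (i m) (t m) b, ?_⟩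
    have e1 : sub (i m) (t m) (piE m ^ p * ser p n κ (run p n κ c₀ i t m) + b ^ p) =
        sub (i m) (t m) (piE m) ^ p * sub (i m) (t m) (ser p n κ (run p n κ c₀ i t m)) +
          sub (i m) (t m) b ^ p := by
      rw [hψ, hψ, hψ, hψ, map_add, map_mul, map_pow, map_pow]
    rw [hPhiS, hpiES, hb, e1, hg,
      add_pow_char (x := MvPowerSeries.X (i m) * sub (i m) (t m) (piE m) * g) (y := sub (i m) (t m) b)]
    ring

/-! ## No long isolated multiplicity-`p` run (`p` odd, `n ≥ 3`) -/

/-- [OURS · L1 W4.6 rung (i) WITH A NUMBER in every dimension; replaces the role of Th. 16.13 p.87 l.25–28 («… but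
FINITELY MANY times») of H. Hironaka's ms. (2017) for the point-blow-up dynamics of a height-one atom, read with a
NUMBER; NOT a statement of the manuscript] **Isolated multiplicity-`p` runs are SHORT**: for `p` an odd prime, `n ≥ 3`
and `κ` perfect of characteristic `p`, if `u_{i 0}^D ∈ jac c₀` then the states `run c₀ i t m`, `m ≤ D + 1`, of the
point-blow-up dynamics cannot all be isolated of multiplicity `p`. (`ConeExit` at the consecutive pairs `≤ D` gives
`dL = 1` below `D`; near directions are invariance directions and the next invariance space is transversal, so the
word is free below `D`; the Frobenius coset at `D + 1`, the derivation lift and the free endgame contradict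
`u_{i 0}^D ∈ jac c₀`.) [folklore] -/
theorem false_of_isol_multP_le (p : ℕ) (hp : p.Prime) (hp2 : p ≠ 2) (hn : 3 ≤ n) [CharP κ p] [PerfectField κ]
    (c₀ : (Fin n → ℕ) → κ) (i : ℕ → Fin n) (t : ℕ → Fin n → κ) {D : ℕ}
    (hD : (X (i 0) : MvPowerSeries (Fin n) κ) ^ D ∈ jac p n κ c₀)
    (hall : ∀ m ≤ D + 1, Isol p n κ (run p n κ c₀ i t m) ∧ MultP p n κ (run p n κ c₀ i t m)) : False := by
  have hn0 : 0 < n := by omega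
  -- the word is free below `D`
  have hfree : ∀ k < D, i (k + 1) = i k ∨ t (k + 1) (i k) ≠ 0 := by
    intro k hk
    by_contra hcon
    have hne : i (k + 1) ≠ i k := fun h => hcon (Or.inl h)
    have ht : t (k + 1) (i k) = 0 := by_contra fun h => hcon (Or.inr h)
    have hdL := (WildConesConeExit.ConeExit_proof p hp hp2 n hn κ (run p n κ c₀ i t k) (i k) (t k)
      (hall k (by omega)).1 (hall k (by omega)).2 (hall (k + 1) (by omega)).1 (hall (k + 1) (by omega)).2).2
    have hv0 := nrd_nearInvariant p hp n hn0 κ (run p n κ c₀ i t k) (i k) (t k) (hall k (by omega)).2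
      (hall (k + 1) (by omega)).2
    have hv1 := nrd_nearInvariant p hp n hn0 κ (run p n κ c₀ i t (k + 1)) (i (k + 1)) (t (k + 1))
      (hall (k + 1) (by omega)).2 (hall (k + 2) (by omega)).2
    have hw : Function.update (t (k + 1)) (i (k + 1)) 1 = 0 :=
      nrd_transversal p hp n hn0 κ (run p n κ c₀ i t k) (i k) (t k) (hall k (by omega)).2 hv0 hdL _ hv1
        (by rw [Function.update_of_ne hne.symm]; exact ht)
    have h1 : Function.update (t (k + 1)) (i (k + 1)) (1 : κ) (i (k + 1)) = 0 := by
      rw [hw]; rfl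
    simp at h1
  -- the chart substitutions, their composites and the pushed exceptional monomials (the route's `let`s, verbatim)
  let sub : Fin n → (Fin n → κ) → MvPowerSeries (Fin n) κ → MvPowerSeries (Fin n) κ := fun i τ f =>
    MvPowerSeries.subst (fun j : Fin n => @ite (MvPowerSeries (Fin n) κ) (j = i) (Classical.dec _)
      (MvPowerSeries.X i) (MvPowerSeries.X i * (MvPowerSeries.X j + MvPowerSeries.C (τ j)))) f
  let Phi : ℕ → MvPowerSeries (Fin n) κ → MvPowerSeries (Fin n) κ := fun m f =>
    @Nat.rec (fun _ => MvPowerSeries (Fin n) κ) f (fun k g => sub (i k) (t k) g) m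
  let piE : ℕ → MvPowerSeries (Fin n) κ := fun m =>
    @Nat.rec (fun _ => MvPowerSeries (Fin n) κ) 1 (fun k g => MvPowerSeries.X (i k) * sub (i k) (t k) g) m
  refine endgame_of_lt sub (fun _ _ _ => rfl) i t Phi piE p hp.two_le (fun l => pd n κ l (ser p n κ c₀))
    (fun _ => rfl) (fun _ _ => rfl) rfl (fun _ => rfl) hD hfree ?_
  intro l
  obtain ⟨b, hb⟩ := coset_of_lt p hp sub (fun _ _ _ => rfl) c₀ i t Phi piE (fun _ => rfl) (fun _ _ => rfl)
    rfl (fun _ => rfl) (D + 1) (fun k hk => (hall k (by omega)).2)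
  exact pdiv_main p i t (a := fun k j => @ite (MvPowerSeries (Fin n) κ) (j = i k) (Classical.dec _)
      (MvPowerSeries.X (i k)) (MvPowerSeries.X (i k) * (MvPowerSeries.X j + MvPowerSeries.C (t k j))))
    (fun _ => if_pos rfl) (fun _ _ hj => if_neg hj) (Phi := Phi) (piE := piE)
    (fun _ => rfl) (fun _ _ => rfl) rfl (fun _ => rfl) (D + 1) l _ _ b hb

/-- [OURS · L1 W4.6 rung (i) WITH A NUMBER in every dimension; NOT a statement of the manuscript] The same with the
bound UNIFORM in the word: if `𝔪^D ≤ jac c₀` (any `D`; one exists iff `Isol c₀`, and `D = μ(c₀)` always works —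
brick 21), then for EVERY chart word `i` and translation word `t` the states `run c₀ i t m`, `m ≤ D + 1`, are not all
isolated of multiplicity `p` (`p` odd, `n ≥ 3`, `κ` perfect). [folklore] -/
theorem false_of_isol_multP_le' (p : ℕ) (hp : p.Prime) (hp2 : p ≠ 2) (hn : 3 ≤ n) [CharP κ p] [PerfectField κ]
    (c₀ : (Fin n → ℕ) → κ) {D : ℕ}
    (hD : IsLocalRing.maximalIdeal (MvPowerSeries (Fin n) κ) ^ D ≤ jac p n κ c₀) (i : ℕ → Fin n)
    (t : ℕ → Fin n → κ)
    (hall : ∀ m ≤ D + 1, Isol p n κ (run p n κ c₀ i t m) ∧ MultP p n κ (run p n κ c₀ i t m)) : False := by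
  have hX : (X (i 0) : MvPowerSeries (Fin n) κ) ∈ IsLocalRing.maximalIdeal (MvPowerSeries (Fin n) κ) := by
    rw [IsLocalRing.mem_maximalIdeal, mem_nonunits_iff, MvPowerSeries.isUnit_iff_constantCoeff]
    simp
  exact false_of_isol_multP_le p hp hp2 hn c₀ i t (hD (Ideal.pow_mem_pow hX D)) hall

end CampaignW46.NarrowRunsBound

end Summit.ResolutionOfSingularities.ResolutionOfSingularities.Theorems

end
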